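import Literature.Geometry.Lorentzian.TameGenericityLocal
import HarnessLib

/-!
# Tame genericity: witness families controlled on a parameter WINDOW only

`TameGenericityLocal.lean` shows that a tame, immersed, GLOBALLY injective and admissible family whose
members with `0 < ‖c‖ < ε` avoid the exceptional set can be reparametrised (radial contraction into the
`ε`-ball, `exists_contDiff_radialContraction`) into a witness of `InitialDataSet.HasTameCodimAtLeastIn`.
Engines that steer inside a finite-dimensional deformation family (kicks paired against dual modes,
gluing parameters) control their curve on a window `‖c‖ < ε` in EVERY respect — injectivity and
membership in the admissible class included (outside the window the family is whatever the ambient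
deformation family happens to be). This file records that window control suffices, by the same
reparametrisation:

* `InitialDataSet.exists_tameFamily_of_localWindow` — tame + immersed at `0` + (injective, admissible,
  `P` off `0`) ON THE WINDOW `‖c‖ < ε` ⇒ a tame, immersed, injective, admissible family through the
  same base datum on the same end all of whose members off `0` satisfy `P`;
* `InitialDataSet.hasTameCodimAtLeastIn_of_localWindow`,
  `InitialDataSet.isTameChristodoulouGeneric_of_localWindow` — the genericity forms.

Christodoulou, CQG **16** (1999) A23, p. A24. Folklore bookkeeping over `TameGenericity.lean`; no
definitions, no named facts, nothing analytic.
-/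

open Manifold Bundle TopologicalSpace Filter Function
open scoped ContDiff Topology

noncomputable section

namespace Literature.Geometry.Lorentzian

namespace InitialDataSet

variable {X : Type*} [TopologicalSpace X] [ChartedSpace E3 X] [IsManifold (𝓡 3) ∞ X]

/-- **Window control suffices.** Let `F : ℝᵐ → InitialDataSet (𝓡 3) X` be tame on the end `e` and
immersed at `0`, and suppose that ON THE WINDOW `‖c‖ < ε` the family is injective, takes values in
`𝓓`, and its members with `c ≠ 0` satisfy `P`. Then there is a family `F'` (namely `F` composed with
the radial contraction of `ℝᵐ` into the `ε`-ball), tame on `e`, with `F' 0 = F 0`, injective,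
immersed at `0`, with every member in `𝓓` and every member off `0` satisfying `P`. Tameness composes
(`IsTameDataFamily.comp_contDiff`), immersion composes (`IsImmersedAtZero.comp_of_injective_fderiv`,
differential `ε • id`), and injectivity / membership / `P` are read on the window, where the
contraction takes its values. Christodoulou, CQG 16 (1999), p. A24. [folklore] -/
theorem exists_tameFamily_of_localWindow {e : AFEnd X} {m : ℕ} {𝓓 : Set (InitialDataSet (𝓡 3) X)}
    {P : InitialDataSet (𝓡 3) X → Prop} {F : EuclideanSpace ℝ (Fin m) → InitialDataSet (𝓡 3) X}
    (hF : IsTameDataFamily e m F) (himm : IsImmersedAtZero m F) {ε : ℝ} (hε : 0 < ε)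
    (hinj : ∀ c c', ‖c‖ < ε → ‖c'‖ < ε → F c = F c' → c = c')
    (h𝓓 : ∀ c, ‖c‖ < ε → F c ∈ 𝓓) (hP : ∀ c, c ≠ 0 → ‖c‖ < ε → P (F c)) :
    ∃ F' : EuclideanSpace ℝ (Fin m) → InitialDataSet (𝓡 3) X,
      IsTameDataFamily e m F' ∧ F' 0 = F 0 ∧ Injective F' ∧ IsImmersedAtZero m F' ∧
        (∀ c, F' c ∈ 𝓓) ∧ ∀ c ≠ 0, P (F' c) := by
  obtain ⟨φ, hφ, hφinj, hφ0, hball, hφne, hdφ⟩ :=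
    exists_contDiff_radialContraction (V := EuclideanSpace ℝ (Fin m)) hε
  have hdinj : Injective (fderiv ℝ φ 0) := by
    rw [hdφ]
    intro v w h
    simpa [hε.ne'] using h
  refine ⟨fun c ↦ F (φ c), hF.comp_contDiff hφ hφ0, by simp [hφ0], ?_,
    himm.comp_of_injective_fderiv hφ0 (hφ.differentiable (by simp) 0) hdinj, fun c ↦ h𝓓 _ (hball c),
    fun c hc ↦ hP _ (fun h ↦ hc (hφne c h)) (hball c)⟩
  intro c c' h
  exact hφinj (hinj _ _ (hball c) (hball c') h)

/-- **Tame codimension from window-controlled families**: it suffices that through every exceptional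
datum pass an end `e` and a family, tame on `e` and immersed at `0`, which on some window `‖c‖ < ε` is
injective, admissible, and avoids `𝓔` off `0`. Christodoulou, CQG 16 (1999), p. A24. [folklore] -/
theorem hasTameCodimAtLeastIn_of_localWindow {𝓓 𝓔 : Set (InitialDataSet (𝓡 3) X)} {m : ℕ}
    (h : ∀ d ∈ 𝓔, ∃ (e : AFEnd X) (ε : ℝ) (F : EuclideanSpace ℝ (Fin m) → InitialDataSet (𝓡 3) X),
      0 < ε ∧ IsTameDataFamily e m F ∧ IsImmersedAtZero m F ∧ F 0 = d ∧
        (∀ c c', ‖c‖ < ε → ‖c'‖ < ε → F c = F c' → c = c') ∧ (∀ c, ‖c‖ < ε → F c ∈ 𝓓) ∧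
          ∀ c, c ≠ 0 → ‖c‖ < ε → F c ∉ 𝓔) :
    HasTameCodimAtLeastIn 𝓓 𝓔 m := by
  intro d hd
  obtain ⟨e, ε, F, hε, hF, himm, h0, hinj, h𝓓, hE⟩ := h d hd
  obtain ⟨F', hF', hF'0, hinj', himm', h𝓓', hE'⟩ :=
    exists_tameFamily_of_localWindow (P := fun D ↦ D ∉ 𝓔) hF himm hε hinj h𝓓 hE
  exact ⟨e, F', hF', himm', hF'0.trans h0, hinj', h𝓓', hE'⟩

/-- **Tame Christodoulou genericity from window-controlled families**: `P` is tame-generic in `𝓓`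
with codimension `m` as soon as through every admissible datum failing `P` pass an end `e` and a
family, tame on `e` and immersed at `0`, which on some window `‖c‖ < ε` is injective, admissible and
satisfies `P` off `0`. Christodoulou, CQG 16 (1999), p. A24. [folklore] -/
theorem isTameChristodoulouGeneric_of_localWindow {𝓓 : Set (InitialDataSet (𝓡 3) X)}
    {P : InitialDataSet (𝓡 3) X → Prop} {m : ℕ}
    (h : ∀ d ∈ 𝓓, ¬ P d → ∃ (e : AFEnd X) (ε : ℝ) (F : EuclideanSpace ℝ (Fin m) → InitialDataSet (𝓡 3) X),
      0 < ε ∧ IsTameDataFamily e m F ∧ IsImmersedAtZero m F ∧ F 0 = d ∧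
        (∀ c c', ‖c‖ < ε → ‖c'‖ < ε → F c = F c' → c = c') ∧ (∀ c, ‖c‖ < ε → F c ∈ 𝓓) ∧
          ∀ c, c ≠ 0 → ‖c‖ < ε → P (F c)) :
    IsTameChristodoulouGeneric 𝓓 P m := by
  refine hasTameCodimAtLeastIn_of_localWindow fun d hd ↦ ?_
  obtain ⟨e, ε, F, hε, hF, himm, h0, hinj, h𝓓, hP⟩ := h d hd.1 hd.2
  exact ⟨e, ε, F, hε, hF, himm, h0, hinj, h𝓓, fun c hc hcε hmem ↦ hmem.2 (hP c hc hcε)⟩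

end InitialDataSet

end Literature.Geometry.Lorentzian

end
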